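import Summits.KontsevichZagierPeriods.KontsevichZagierPeriods.Theses.TorsionLogs
import Summits.KontsevichZagierPeriods.KontsevichZagierPeriods.Theorems.TorsionLogsNeronTorsionSector
import Literature.NumberTheory.Transcendental.KZKernelConjectureForms
import Literature.NumberTheory.Transcendental.KZLogCalculusProofs

/-!
# Crux `TorsionSectorComplete` (stmt-KontsevichZagierPeriods-14212) — line `NeronTorsionVariation`
# (forward generator G1 `next-rung` over the floor `NeronTorsionPrimitiveChain`, unit fwd2-rung-KontsevichZagierPeriods-01, gen 12)

Route `TorsionLogs` (route-KontsevichZagierPeriods-TorsionLogs; `closes (h₁ : NeronTorsionSector)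
(h₂ : TorsionSectorComplete) : KontsevichZagierPeriods`; `h₁` CLOSED by the landed translation chain
`NeronTorsionSector_of = NeronTorsionSector_of_primitiveChain stub_assembly`, `h₂` the open residual).

FLOOR (seed g1-KontsevichZagierPeriods-17981, CLOSED): `Theses.TorsionLogs.NeronTorsionPrimitiveChain` — the Néron–torsion
chain `q²•[rI] + p²•[rP] − c•[rB] ∈ KZ.relations` at ONE real `N`-torsion point `P` on the identity component of ONE curve
`y² = f(x) = 4x³ − g₂x − g₃` (`rI` = the iterated triangle `e₁ < x₁ < x₀ < x_P` of `x₁dx₁dx₀/(√f√f)`, `rP` = the quadrant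
carrier of `η₁ω₁/2`, `rB` = a log carrier; in value `q²·I + p²·η₁ω₁/2 = c·log B`).

ONE MOVE — JET ORDER in the MODULUS, j : 0 → 1.  Every earlier line on this crux varies the POINT (corner, coset, oval,
non-real point, free point), the FIBRE TYPE (acnodal) or the LENGTH (ℓ = 3) at a FIXED curve; none moves the curve.  The
torsion datum cuts out an algebraic curve `{(t, x_P(t))}` (a component of the modular curve `Y₁(N)` over the real
`j`-line) inside the pencil of cubics through the fixed 2-torsion abscissa `e₁`,
  `f_t(x) = 4x³ − t·x − (4e₁³ − t·e₁) = (x − e₁)(4x² + 4e₁x + 4e₁² − t)`,   `∂ₜ f_t = −(x − e₁)`,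
  `∂ₜ (f_t)^{-1/2} = (x − e₁)/(2·√f_t³)`  (integrable at `e₁`),
along which the floor's value identity `F(t) := q²·I(t) + p²·V(t) = log A(t)` holds with `A` an ALGEBRAIC FUNCTION on that
curve (Klein forms: `𝔨(u_P)^{12N}Δ^N` is a modular unit of level `N`).  Differentiating at the floor's fibre `t₀ = g₂`:
`F′(t₀) = β` is ALGEBRAIC, and `F′` is a sum of honest periods — the Leibniz boundary term of the moving corner `x_P(t)`
and the interior `t`-derivatives:

  `r₁ = [e₁<x<x_P,  (ξ/√f(x_P))·x/√f(x)]`                         (boundary: `ξ = dx_P/dt`, corner speed),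
  `rD = [e₁<z₁<z₀<x_P,  z₁·((z₁−e₁)/(2√f(z₁)³√f(z₀)) + (z₀−e₁)/(2√f(z₁)√f(z₀)³))]`   (= ∂ₜ of the floor's triangle integrand),
  `rW = [(e₁,∞)², ∂ₜ((√f(z₀))⁻¹·(g₂z₁+2g₃)/(2z₁²√f(z₁)))]`  with `ġ₂ = 1`, `ġ₃ = −e₁`      (= ∂ₜ of the `η₁ω₁/2` carrier),
  `rb = [0<t<1, β]`                                                (an algebraic constant),

and the member `true` of the rung says   `q²•([r₁] + [rD]) + p²•[rW] − [rb] ∈ KZ.relations`   whenever (TIED form) the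
values satisfy `q²(r₁ + rD) + p²·rW = rb`; the direction `ξ` is pinned by the TANGENCY DATUM (the `t`-derivative of the
floor's torsion datum `N∫_{x_P}^∞ dx/√f = a·ω₁`):  `N·(−ξ/√f(x_P) + ∫_{x_P}^∞ ∂ₜf^{-1/2}) = a·2∫_{e₁}^∞ ∂ₜf^{-1/2}`.
TRUE INSTANCE (value level, checked): with Néron's archimedean local height `λ(z) = ½Re(z·η(z)) − log|σ(z)| −
(1/12)·log|Δ|` and the multiplication law `λ([m]P) = m²λ(P) − ½·log|F_m(P)| + ((m²−1)/12)·log|Δ|` (`F_m = ψ_m²`,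
[SilvermanATAEC1994, VI Thm 3.2, Ex. 6.4(e)]), the floor's left side is `F = q²·(λ(P) − λ(T))`, `T = (e₁, 0)`, and
`[N−1]P = −P`, `[3]T = T` evaluate it:  `F(t) = q²·( log F_{N−1}(P_t) / (2N(N−2)) − ¼·log(3e₁² − t/4) )`  — the floor's
`c·log B` in closed form (`F_{N−1}` the squared division polynomial of `y² = x³ − (t/4)x − g₃/4`, `3e₁² − t/4 = f′(e₁)/4`).
Hence `β = F′(t₀) = q²·( Ḟ_{N−1}(P_t)/(2N(N−2)·F_{N−1}(P_t)) + (1/16)/(3e₁² − t₀/4) ) ∈ ℚ(t₀, e₁, x_P, y_P, ξ) ⊂ ℚ̄`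
(`ξ = dx_P/dt` is algebraic: implicit differentiation of `ψ_N(x_P(t); t) = 0`).  Leibniz' rule (moving corner `x_P(t)`) and
differentiation under the integral sign (all `t`-derivatives have integrable `(x−e₁)^{-1/2}` singularities) identify
`F′(t₀)` with the values `q²(r₁ + rD) + p²·rW`.  NUMERICS (seat folder `num/variation_table.py`, 12 instances, `N ∈ {3,…,7}`,
both signs of `Δ`): floor identity vs the closed form to ≤ 7.4e-11; the explicit derivative representations vs `β` (Richardson
derivative of the closed form along the solved torsion curve) to ≤ 6.0e-9; table in the line card.

WHY ONE MOVE UP NEEDS A NEW IDEA: the floor's chain (translation cocycle on the grid, corner charts, integer log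
elimination) lives on ONE fibre; no move of it produces `∂ₜ`.  The jet member needs (i) the GAUSS–MANIN REDUCTION of
`∂ₜ(dx/√f)` — `∂_{g₂}ω ≡ α·ω + β·x·ω + d(φ)` with `α, β ∈ ℚ(g₂,g₃)`, `φ` rational (Fricke/Halphen), read as Newton–Leibniz
moves with ALGEBRAIC primitives on the triangle and the quadrant, boundary terms landing on the edges — and (ii) the
DEPTH-ONE SECOND-KIND TORSION IDENTITY `N·ζ(u_P) − a·η₁ ∈ ℚ̄` (translation by `P` of `x dx/y`: `ζ(u+u_P) − ζ(u) − ζ(u_P) =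
½(℘′u − ℘′u_P)/(℘u − ℘u_P)`) as a ONE-dimensional KZ relation `2N•[∫_{e₁}^{x_P} x dx/√f] − (N−2a)•[η₁] + [const] ∈ relations`,
which the floor never uses (its second-kind periods only enter through the complete quadrant `η₁ω₁/2`).

FAMILY (honest containment): `NeronTorsionJetMember : Bool → Prop`, `false ↦` the floor decl VERBATIM (j = 0),
`true ↦ NeronTorsionVariationSector` (j = 1); THE RUNG `NeronTorsionJets := ∀ j, NeronTorsionJetMember j`.  The family is
graded by the jet order j ∈ {0, 1} at the same fibre and nothing else varies.

SKELETON (2 registered stubs → the crux BY NAME):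
* `stub_variationChain : VariationPrimitiveChain` (XL, THE REAL STEP) — the primitive (∃-form) first-variation chain: some
  algebraic `β` and constant carrier `rb` with the element in `KZ.relations`.
* `stub_variationSectorComplete : VariationSectorComplete` (residual, conjecture-grade) — completeness of rational-shape
  equalities modulo `relations ⊔ closure (T ∪ T′)`, `T` the crux's tied set, `T′` the tied first-variation set; WEAKER than
  the crux (`variationSectorComplete_of_torsionSectorComplete`).
Proved here (no `sorry`): the tied member from the primitive chain (`variationSector_of_primitiveChain`: soundness and the
congruence move `KZ.of_sub_of_mem_relations_of_eqOn` for the two constant carriers), the rung, `closure T′ ≤ relations`,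
`closure T ≤ relations` (the closed sibling crux `NeronTorsionSector_of`), the F4 on-path theorem, and `TorsionSectorComplete_of`.
-/

noncomputable section

open Set MeasureTheory Filter Topology
open Literature.NumberTheory.Transcendental Literature.ModelTheory.ExponentialFields
open Summit.KontsevichZagierPeriods.KontsevichZagierPeriods.Theses.TorsionLogs (NeronTorsionSector NeronTorsionPrimitiveChain
  NeronTorsionPrimitiveChain_holds TorsionSectorComplete)
open Summit.KontsevichZagierPeriods.KontsevichZagierPeriods.Cruxes.NeronTorsionSector.Translation (NeronTorsionSector_of)

-- `Summit.KontsevichZagierPeriods.KontsevichZagierPeriods.…` is the tree's mandated layout (single-conjunct summit).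
set_option linter.dupNamespace false

namespace Summit.KontsevichZagierPeriods.KontsevichZagierPeriods.Cruxes.TorsionSectorComplete.NeronTorsionVariation

/-! ### Statements -/

/-- **Member `true` (j = 1): the TIED FIRST-VARIATION NÉRON–TORSION SECTOR STATEMENT.** For the floor's curve/torsion
data verbatim (real cubic `f = 4x³ − g₂x − g₃`, `g₂³ ≠ 27g₃²`, largest root `e₁ > 0`, `f > 0` beyond, `P = (x_P, y_P)` of
exact order `N ≥ 3` on the identity component with `N∫_{x_P}^∞ dx/√f = a·ω₁`, `0 < 2a < N`, `q(N − 2a) = p·2N` in lowest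
terms), a direction `ξ` satisfying the TANGENCY DATUM (the `t`-derivative of the torsion datum along the pencil
`f_t = (x − e₁)(4x² + 4e₁x + 4e₁² − t)`, `∂ₜf^{-1/2} = (x − e₁)/(2√f³)`), and representations pinned as
`r₁ = [e₁<x<x_P, (ξ/√f(x_P))·x/√f]`, `rD = [e₁<z₁<z₀<x_P, ∂ₜ(z₁/(√f(z₁)√f(z₀)))]`, `rW = [(e₁,∞)², ∂ₜ((√f(z₀))⁻¹(g₂z₁+2g₃)/(2z₁²√f(z₁)))]`,
`rb = [0<t<1, β]`: the VALUE HYPOTHESIS `q²(r₁ + rD) + p²·rW = rb` gives `q²•([r₁]+[rD]) + p²•[rW] − [rb] ∈ KZ.relations`.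
[cite: KontsevichZagier2001, §1.2] [cite: Lang1987, Ch. 2 §1] [cite: SilvermanATAEC1994, VI Ex. 6.4] -/
def NeronTorsionVariationSector : Prop :=
  ∀ (g₂ g₃ e₁ xP yP ξ β : ℝ) (N a p q : ℕ) (f : ℝ → ℝ),
    (∀ x, f x = 4 * x ^ 3 - g₂ * x - g₃) → g₂ ^ 3 - 27 * g₃ ^ 2 ≠ 0 → f e₁ = 0 → 0 < e₁ →
    (∀ x, e₁ < x → 0 < f x) → e₁ < xP → yP ^ 2 = f xP → 3 ≤ N → 0 < a → 2 * a < N →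
    (∀ hns : (⟨0, 0, 0, -g₂ / 4, -g₃ / 4⟩ : WeierstrassCurve ℝ).toAffine.Nonsingular xP (yP / 2),
      addOrderOf (WeierstrassCurve.Affine.Point.some xP (yP / 2) hns) = N) →
    (N : ℝ) * (∫ x in Set.Ioi xP, (Real.sqrt (f x))⁻¹) = a * (2 * ∫ x in Set.Ioi e₁, (Real.sqrt (f x))⁻¹) →
    Nat.Coprime p q → (q : ℤ) * ((N : ℤ) - 2 * (a : ℤ)) = (p : ℤ) * (2 * (N : ℤ)) →
    (N : ℝ) * (-(ξ / Real.sqrt (f xP)) + ∫ x in Set.Ioi xP, (x - e₁) / (2 * Real.sqrt (f x) ^ 3)) =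
      a * (2 * ∫ x in Set.Ioi e₁, (x - e₁) / (2 * Real.sqrt (f x) ^ 3)) →
    ∀ (r₁ rb : KZ.IntegralRep 1) (rD rW : KZ.IntegralRep 2),
    r₁.domain = {t | e₁ < t 0 ∧ t 0 < xP} →
    Set.EqOn r₁.integrand (fun t => ξ / Real.sqrt (f xP) * (t 0 / Real.sqrt (f (t 0)))) r₁.domain →
    rD.domain = {z | e₁ < z 1 ∧ z 1 < z 0 ∧ z 0 < xP} →
    Set.EqOn rD.integrand (fun z => z 1 * ((z 1 - e₁) / (2 * Real.sqrt (f (z 1)) ^ 3 * Real.sqrt (f (z 0)))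
      + (z 0 - e₁) / (2 * Real.sqrt (f (z 1)) * Real.sqrt (f (z 0)) ^ 3))) rD.domain →
    rW.domain = {z | e₁ < z 0 ∧ e₁ < z 1} →
    Set.EqOn rW.integrand (fun z => (z 0 - e₁) / (2 * Real.sqrt (f (z 0)) ^ 3) *
        ((g₂ * z 1 + 2 * g₃) / (2 * (z 1) ^ 2 * Real.sqrt (f (z 1))))
      + (Real.sqrt (f (z 0)))⁻¹ * ((z 1 - 2 * e₁) / (2 * (z 1) ^ 2 * Real.sqrt (f (z 1)))
        + (g₂ * z 1 + 2 * g₃) * (z 1 - e₁) / (4 * (z 1) ^ 2 * Real.sqrt (f (z 1)) ^ 3))) rW.domain →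
    rb.domain = {t | 0 < t 0 ∧ t 0 < 1} → Set.EqOn rb.integrand (fun _ => β) rb.domain →
    (q : ℝ) ^ 2 * (r₁.value + rD.value) + (p : ℝ) ^ 2 * rW.value = rb.value →
    ((q : ℤ) ^ 2) • (KZ.of r₁ + KZ.of rD) + ((p : ℤ) ^ 2) • KZ.of rW - KZ.of rb ∈ KZ.relations

/-- **The family, graded by the jet order in the modulus (`false` ↦ j = 0, `true` ↦ j = 1).** Member `false` is the
floor decl `Theses.TorsionLogs.NeronTorsionPrimitiveChain` VERBATIM (the seed, CLOSED); member `true` is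
`NeronTorsionVariationSector`. Honest containment: the family is indexed by j ∈ {0, 1} at the same fibre, nothing else
varies. -/
def NeronTorsionJetMember : Bool → Prop
  | false => NeronTorsionPrimitiveChain
  | true => NeronTorsionVariationSector

/-- **THE RUNG `NeronTorsionJets`: both jet orders.** `∀ j, NeronTorsionJetMember j` — the proved floor (j = 0) and the new
first-variation sector statement (j = 1). -/
def NeronTorsionJets : Prop := ∀ one : Bool, NeronTorsionJetMember one

/-- **Stub A statement (XL, THE REAL STEP): the PRIMITIVE FIRST-VARIATION NÉRON–TORSION CHAIN.**  Same data, tangency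
datum and pinned representations as the tied member, no `β`/`rb`/value hypothesis: there EXIST an algebraic `β` and a
constant carrier `rb = [0<t<1, β]` with the first-variation element in `KZ.relations`.  Plan: (i) Gauss–Manin reduction
of the interior derivatives `rD`, `rW` — Newton–Leibniz moves on the triangle / quadrant with the ALGEBRAIC primitives of
`∂_{g₂}(dx/√f) ≡ α·dx/√f + β·x dx/√f + dφ` (`α, β ∈ ℚ(g₂, g₃)`, `φ = (linear in x)/f·√f`), boundary terms on the edges
`z₁ = e₁`, `z₀ = x_P`; (ii) the depth-one second-kind torsion identity `2N•[∫_{e₁}^{x_P} x dx/√f] − (N−2a)•[η₁] + [const]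
∈ relations` (translation by `P` of `x dx/y`, the floor's cocycle one form down) to evaluate the edge terms at the
torsion corner; (iii) the floor itself for the undifferentiated block; (iv) cancellation of the `ω₁²`, `ω₁η₁`, `η₁²`
carriers forced by the Legendre-weighted Picard–Fuchs system.
[cite: KontsevichZagier2001, §1.2] [cite: Lang1987, Ch. 2 §1] [cite: SilvermanATAEC1994, VI Ex. 6.4] -/
def VariationPrimitiveChain : Prop :=
  ∀ (g₂ g₃ e₁ xP yP ξ : ℝ) (N a p q : ℕ) (f : ℝ → ℝ),
    (∀ x, f x = 4 * x ^ 3 - g₂ * x - g₃) → g₂ ^ 3 - 27 * g₃ ^ 2 ≠ 0 → f e₁ = 0 → 0 < e₁ →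
    (∀ x, e₁ < x → 0 < f x) → e₁ < xP → yP ^ 2 = f xP → 3 ≤ N → 0 < a → 2 * a < N →
    (∀ hns : (⟨0, 0, 0, -g₂ / 4, -g₃ / 4⟩ : WeierstrassCurve ℝ).toAffine.Nonsingular xP (yP / 2),
      addOrderOf (WeierstrassCurve.Affine.Point.some xP (yP / 2) hns) = N) →
    (N : ℝ) * (∫ x in Set.Ioi xP, (Real.sqrt (f x))⁻¹) = a * (2 * ∫ x in Set.Ioi e₁, (Real.sqrt (f x))⁻¹) →
    Nat.Coprime p q → (q : ℤ) * ((N : ℤ) - 2 * (a : ℤ)) = (p : ℤ) * (2 * (N : ℤ)) →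
    (N : ℝ) * (-(ξ / Real.sqrt (f xP)) + ∫ x in Set.Ioi xP, (x - e₁) / (2 * Real.sqrt (f x) ^ 3)) =
      a * (2 * ∫ x in Set.Ioi e₁, (x - e₁) / (2 * Real.sqrt (f x) ^ 3)) →
    ∀ (r₁ : KZ.IntegralRep 1) (rD rW : KZ.IntegralRep 2),
    r₁.domain = {t | e₁ < t 0 ∧ t 0 < xP} →
    Set.EqOn r₁.integrand (fun t => ξ / Real.sqrt (f xP) * (t 0 / Real.sqrt (f (t 0)))) r₁.domain →
    rD.domain = {z | e₁ < z 1 ∧ z 1 < z 0 ∧ z 0 < xP} →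
    Set.EqOn rD.integrand (fun z => z 1 * ((z 1 - e₁) / (2 * Real.sqrt (f (z 1)) ^ 3 * Real.sqrt (f (z 0)))
      + (z 0 - e₁) / (2 * Real.sqrt (f (z 1)) * Real.sqrt (f (z 0)) ^ 3))) rD.domain →
    rW.domain = {z | e₁ < z 0 ∧ e₁ < z 1} →
    Set.EqOn rW.integrand (fun z => (z 0 - e₁) / (2 * Real.sqrt (f (z 0)) ^ 3) *
        ((g₂ * z 1 + 2 * g₃) / (2 * (z 1) ^ 2 * Real.sqrt (f (z 1))))
      + (Real.sqrt (f (z 0)))⁻¹ * ((z 1 - 2 * e₁) / (2 * (z 1) ^ 2 * Real.sqrt (f (z 1)))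
        + (g₂ * z 1 + 2 * g₃) * (z 1 - e₁) / (4 * (z 1) ^ 2 * Real.sqrt (f (z 1)) ^ 3))) rW.domain →
    ∃ (β : ℝ) (rb : KZ.IntegralRep 1), IsAlgebraic ℚ β ∧
      rb.domain = {t | 0 < t 0 ∧ t 0 < 1} ∧ Set.EqOn rb.integrand (fun _ => β) rb.domain ∧
      ((q : ℤ) ^ 2) • (KZ.of r₁ + KZ.of rD) + ((p : ℤ) ^ 2) • KZ.of rW - KZ.of rb ∈ KZ.relations

/-- The identity-component tied set `T` of the crux `TorsionSectorComplete` (copied verbatim). -/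
def TorsionTied : Set Literature.NumberTheory.Transcendental.KZ.FormalRep := {d : Literature.NumberTheory.Transcendental.KZ.FormalRep | ∃ (g₂ g₃ e₁ xP yP α : ℝ) (N a : ℕ) (M k m : ℤ) (f : ℝ → ℝ) (rI rP : Literature.NumberTheory.Transcendental.KZ.IntegralRep 2) (rL : Literature.NumberTheory.Transcendental.KZ.IntegralRep 1), (∀ x, f x = 4 * x ^ 3 - g₂ * x - g₃) ∧ g₂ ^ 3 - 27 * g₃ ^ 2 ≠ 0 ∧ f e₁ = 0 ∧ 0 < e₁ ∧ (∀ x, e₁ < x → 0 < f x) ∧ e₁ < xP ∧ yP ^ 2 = f xP ∧ 3 ≤ N ∧ 0 < a ∧ 2 * a < N ∧ 4 * (N : ℤ) ^ 2 * k = M * ((N : ℤ) - 2 * (a : ℤ)) ^ 2 ∧ (∀ hns : (⟨0, 0, 0, -g₂ / 4, -g₃ / 4⟩ : WeierstrassCurve ℝ).toAffine.Nonsingular xP (yP / 2), addOrderOf (WeierstrassCurve.Affine.Point.some xP (yP / 2) hns) = N) ∧ (N : ℝ) * (∫ x in Set.Ioi xP, (Real.sqrt (f x))⁻¹) = a * (2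 * ∫ x in Set.Ioi e₁, (Real.sqrt (f x))⁻¹) ∧ 1 < α ∧ rI.domain = {z | e₁ < z 1 ∧ z 1 < z 0 ∧ z 0 < xP} ∧ Set.EqOn rI.integrand (fun z => z 1 / (Real.sqrt (f (z 1)) * Real.sqrt (f (z 0)))) rI.domain ∧ rP.domain = {z | e₁ < z 0 ∧ e₁ < z 1} ∧ Set.EqOn rP.integrand (fun z => (Real.sqrt (f (z 0)))⁻¹ * ((g₂ * z 1 + 2 * g₃) / (2 * (z 1) ^ 2 * Real.sqrt (f (z 1))))) rP.domain ∧ rL.domain = {t | 1 < t 0 ∧ t 0 < α} ∧ Set.EqOn rL.integrand (fun t => (t 0)⁻¹) rL.domain ∧ (M : ℝ) * rI.value + k * rP.value = m * rL.value ∧ d = M • Literature.NumberTheory.Transcendental.KZ.of rI + k • Literature.NumberTheory.Transcendental.KZ.of rP - m • Literature.NumberTheory.Transcendental.KZ.of rL}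

/-- The tied FIRST-VARIATION set `T′`: the elements of the member `true`, with their value hypothesis. -/
def VariationTied : Set Literature.NumberTheory.Transcendental.KZ.FormalRep :=
  {d | ∃ (g₂ g₃ e₁ xP yP ξ β : ℝ) (N a p q : ℕ) (f : ℝ → ℝ) (r₁ rb : KZ.IntegralRep 1) (rD rW : KZ.IntegralRep 2),
    (∀ x, f x = 4 * x ^ 3 - g₂ * x - g₃) ∧ g₂ ^ 3 - 27 * g₃ ^ 2 ≠ 0 ∧ f e₁ = 0 ∧ 0 < e₁ ∧
    (∀ x, e₁ < x → 0 < f x) ∧ e₁ < xP ∧ yP ^ 2 = f xP ∧ 3 ≤ N ∧ 0 < a ∧ 2 * a < N ∧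
    (∀ hns : (⟨0, 0, 0, -g₂ / 4, -g₃ / 4⟩ : WeierstrassCurve ℝ).toAffine.Nonsingular xP (yP / 2),
      addOrderOf (WeierstrassCurve.Affine.Point.some xP (yP / 2) hns) = N) ∧
    (N : ℝ) * (∫ x in Set.Ioi xP, (Real.sqrt (f x))⁻¹) = a * (2 * ∫ x in Set.Ioi e₁, (Real.sqrt (f x))⁻¹) ∧
    Nat.Coprime p q ∧ (q : ℤ) * ((N : ℤ) - 2 * (a : ℤ)) = (p : ℤ) * (2 * (N : ℤ)) ∧
    (N : ℝ) * (-(ξ / Real.sqrt (f xP)) + ∫ x in Set.Ioi xP, (x - e₁) / (2 * Real.sqrt (f x) ^ 3)) =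
      a * (2 * ∫ x in Set.Ioi e₁, (x - e₁) / (2 * Real.sqrt (f x) ^ 3)) ∧
    r₁.domain = {t | e₁ < t 0 ∧ t 0 < xP} ∧
    Set.EqOn r₁.integrand (fun t => ξ / Real.sqrt (f xP) * (t 0 / Real.sqrt (f (t 0)))) r₁.domain ∧
    rD.domain = {z | e₁ < z 1 ∧ z 1 < z 0 ∧ z 0 < xP} ∧
    Set.EqOn rD.integrand (fun z => z 1 * ((z 1 - e₁) / (2 * Real.sqrt (f (z 1)) ^ 3 * Real.sqrt (f (z 0)))
      + (z 0 - e₁) / (2 * Real.sqrt (f (z 1)) * Real.sqrt (f (z 0)) ^ 3))) rD.domain ∧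
    rW.domain = {z | e₁ < z 0 ∧ e₁ < z 1} ∧
    Set.EqOn rW.integrand (fun z => (z 0 - e₁) / (2 * Real.sqrt (f (z 0)) ^ 3) *
        ((g₂ * z 1 + 2 * g₃) / (2 * (z 1) ^ 2 * Real.sqrt (f (z 1))))
      + (Real.sqrt (f (z 0)))⁻¹ * ((z 1 - 2 * e₁) / (2 * (z 1) ^ 2 * Real.sqrt (f (z 1)))
        + (g₂ * z 1 + 2 * g₃) * (z 1 - e₁) / (4 * (z 1) ^ 2 * Real.sqrt (f (z 1)) ^ 3))) rW.domain ∧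
    rb.domain = {t | 0 < t 0 ∧ t 0 < 1} ∧ Set.EqOn rb.integrand (fun _ => β) rb.domain ∧
    (q : ℝ) ^ 2 * (r₁.value + rD.value) + (p : ℝ) ^ 2 * rW.value = rb.value ∧
    d = ((q : ℤ) ^ 2) • (KZ.of r₁ + KZ.of rD) + ((p : ℤ) ^ 2) • KZ.of rW - KZ.of rb}

/-- **Stub D statement (residual, conjecture-grade): completeness off the sector enlarged by the first-variation
elements.**  Two rational-shape representations with equal values differ by an element of
`relations ⊔ closure (T ∪ T′)`.  Between `KZKernelConjecture` (`relations` alone) and the crux (`relations ⊔ closure T`);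
WEAKER than the crux (`variationSectorComplete_of_torsionSectorComplete`). [cite: KontsevichZagier2001, §1.2 Conjecture 1] -/
def VariationSectorComplete : Prop := ∀ ⦃n m : ℕ⦄ (r : Literature.NumberTheory.Transcendental.KZ.IntegralRep n) (r' : Literature.NumberTheory.Transcendental.KZ.IntegralRep m), r.IsRational → r'.IsRational → r.value = r'.value → Literature.NumberTheory.Transcendental.KZ.of r - Literature.NumberTheory.Transcendental.KZ.of r' ∈ Literature.NumberTheory.Transcendental.KZ.relations ⊔ AddSubgroup.closure (TorsionTied ∪ VariationTied)

/-! ### Registered stubs -/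

/-- **Stub A (XL, load-bearing, the new move).** `VariationPrimitiveChain`. -/
theorem stub_variationChain : VariationPrimitiveChain := by
  sorry

/-- **Stub D (residual, conjecture-grade).** `VariationSectorComplete`. -/
theorem stub_variationSectorComplete : VariationSectorComplete := by
  sorry

/-! ### Proved infrastructure (no `sorry` below this line) -/

/-- The crux unfolds to completeness relative to `relations ⊔ closure T`. -/
theorem torsionSectorComplete_iff :
    TorsionSectorComplete ↔ ∀ ⦃n m : ℕ⦄ (r : Literature.NumberTheory.Transcendental.KZ.IntegralRep n) (r' : Literature.NumberTheory.Transcendental.KZ.IntegralRep m), r.IsRational → r'.IsRational → r.value = r'.value → Literature.NumberTheory.Transcendental.KZ.of r - Literature.NumberTheory.Transcendental.KZ.of r' ∈ Literature.NumberTheory.Transcendental.KZ.relations ⊔ AddSubgroup.closure TorsionTied :=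
  Iff.rfl

/-- Member `false` is the floor, definitionally. -/
theorem member_false_iff : NeronTorsionJetMember false ↔ NeronTorsionPrimitiveChain := Iff.rfl

/-- Member `true` is the first-variation statement, definitionally. -/
theorem member_true_iff : NeronTorsionJetMember true ↔ NeronTorsionVariationSector := Iff.rfl

/-- The rung is the floor plus the new member. -/
theorem neronTorsionJets_iff : NeronTorsionJets ↔ NeronTorsionPrimitiveChain ∧ NeronTorsionVariationSector := by
  constructor
  · exact fun h => ⟨h false, h true⟩
  · rintro ⟨h₀, h₁⟩ (_ | _)
    · exact h₀
    · exact h₁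

/-- **F3 WITNESS: the rung at the floor.** Member `false` is the CLOSED seed `NeronTorsionPrimitiveChain`
(`Cruxes.NeronTorsionSector.Translation.stub_assembly`, landed; route link `NeronTorsionPrimitiveChain_holds`). -/
theorem rung_false : NeronTorsionJetMember false := NeronTorsionPrimitiveChain_holds

/-- Value of a pinned constant carrier `rb = [0<t<1, β]` (`MeasurableEquiv.funUnique`, `volume_preserving_funUnique`).
[folklore] -/
theorem value_unitConst {β : ℝ} (rb : KZ.IntegralRep 1) (hdb : rb.domain = {t | 0 < t 0 ∧ t 0 < 1})
    (hib : Set.EqOn rb.integrand (fun _ => β) rb.domain) : rb.value = β := by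
  rw [KZ.IntegralRep.value]
  have hmeas : MeasurableSet rb.domain := by
    rw [hdb]
    exact (measurableSet_lt measurable_const (measurable_pi_apply 0)).inter
      (measurableSet_lt (measurable_pi_apply 0) measurable_const)
  rw [setIntegral_congr_fun hmeas hib, hdb]
  have hpre : {t : Fin 1 → ℝ | 0 < t 0 ∧ t 0 < 1} = MeasurableEquiv.funUnique (Fin 1) ℝ ⁻¹' Set.Ioo 0 1 := by
    ext x
    simp [MeasurableEquiv.funUnique, Fin.default_eq_zero]
  have key := (volume_preserving_funUnique (Fin 1) ℝ).setIntegral_preimage_emb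
    (MeasurableEquiv.funUnique (Fin 1) ℝ).measurableEmbedding (fun _ : ℝ => β) (Set.Ioo 0 1)
  rw [hpre]
  refine key.trans ?_
  simp

/-- **Bookkeeping: the primitive first-variation chain gives the tied member.**  Soundness of `relations` for the
chain's value and the two pinned constant carriers: the value hypothesis forces `β₀ = β`, so `[rb₀] − [rb]` is the
congruence move `KZ.of_sub_of_mem_relations_of_eqOn`. [cite: KontsevichZagier2001, §1.2] -/
theorem variationSector_of_primitiveChain (hPC : VariationPrimitiveChain) : NeronTorsionVariationSector := by
  intro g₂ g₃ e₁ xP yP ξ β N a p q f hf hdisc he he0 hpos hx hy hN ha ha2 hord htor hpq htie htan r₁ rb rD rW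
    hd1 hi1 hdD hiD hdW hiW hdb hib hval
  obtain ⟨β₀, rb₀, -, hdb₀, hib₀, hprim⟩ :=
    hPC g₂ g₃ e₁ xP yP ξ N a p q f hf hdisc he he0 hpos hx hy hN ha ha2 hord htor hpq htie htan r₁ rD rW
      hd1 hi1 hdD hiD hdW hiW
  have hvb₀ : rb₀.value = β₀ := value_unitConst rb₀ hdb₀ hib₀
  have hvb : rb.value = β := value_unitConst rb hdb hib
  have h0 : (q : ℝ) ^ 2 * (r₁.value + rD.value) + (p : ℝ) ^ 2 * rW.value - β₀ = 0 := by
    have h := KZ.relations_le_ker_eval_holds hprim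
    rw [AddMonoidHom.mem_ker] at h
    simp only [map_add, map_sub, map_zsmul, KZ.eval_of, zsmul_eq_mul, hvb₀] at h
    push_cast at h
    linear_combination h
  have hββ : β₀ = β := by
    rw [hvb] at hval
    linear_combination hval - h0
  have hL : KZ.of rb₀ - KZ.of rb ∈ KZ.relations := by
    refine KZ.of_sub_of_mem_relations_of_eqOn (by rw [hdb, hdb₀]) (fun t ht => ?_)
    have ht' : t ∈ rb.domain := by
      rw [hdb]
      rw [hdb₀] at ht
      exact ht
    rw [hib₀ ht, hib ht', hββ]
  have e : ((q : ℤ) ^ 2) • (KZ.of r₁ + KZ.of rD) + ((p : ℤ) ^ 2) • KZ.of rW - KZ.of rb =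
      (((q : ℤ) ^ 2) • (KZ.of r₁ + KZ.of rD) + ((p : ℤ) ^ 2) • KZ.of rW - KZ.of rb₀) + (KZ.of rb₀ - KZ.of rb) := by
    abel
  rw [e]
  exact KZ.relations.add_mem hprim hL

/-- The rung from stub A (the floor is a theorem). -/
theorem neronTorsionJets_of (hA : VariationPrimitiveChain) : NeronTorsionJets :=
  neronTorsionJets_iff.mpr ⟨NeronTorsionPrimitiveChain_holds, variationSector_of_primitiveChain hA⟩

/-- The first-variation member says exactly `closure T′ ≤ KZ.relations`. [cite: KontsevichZagier2001, §1.2] -/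
theorem closure_variationTied_le_relations (h : NeronTorsionVariationSector) :
    AddSubgroup.closure VariationTied ≤ Literature.NumberTheory.Transcendental.KZ.relations := by
  refine (AddSubgroup.closure_le _).mpr ?_
  rintro d ⟨g₂, g₃, e₁, xP, yP, ξ, β, N, a, p, q, f, r₁, rb, rD, rW, hf, hdisc, he, he0, hpos, hx, hy, hN, ha, ha',
    hord, htor, hpq, htie, htan, hd1, hi1, hdD, hiD, hdW, hiW, hdb, hib, hval, rfl⟩
  exact h g₂ g₃ e₁ xP yP ξ β N a p q f hf hdisc he he0 hpos hx hy hN ha ha' hord htor hpq htie htan r₁ rb rD rW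
    hd1 hi1 hdD hiD hdW hiW hdb hib hval

/-- The identity-component sector (the route's CLOSED sibling crux `NeronTorsionSector`, landed as
`NeronTorsionSector_of`) says exactly `closure T ≤ KZ.relations`. [cite: KontsevichZagier2001, §1.2] -/
theorem closure_torsionTied_le_relations :
    AddSubgroup.closure TorsionTied ≤ Literature.NumberTheory.Transcendental.KZ.relations := by
  have h : NeronTorsionSector := NeronTorsionSector_of
  refine (AddSubgroup.closure_le _).mpr ?_
  rintro d ⟨g₂, g₃, e₁, xP, yP, α, N, a, M, k, m', f, rI, rP, rL, hf, hdisc, he, he0, hpos, hx, hy, hN, ha,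
    ha', htie, hord, htor, hα, hdI, hiI, hdP, hiP, hdL, hiL, hval, rfl⟩
  exact h g₂ g₃ e₁ xP yP α N a M k m' f hf hdisc he he0 hpos hx hy hN ha ha' htie hord htor hα rI rP rL hdI hiI
    hdP hiP hdL hiL hval

/-- **F4 ON-PATH, new member:** Conjecture 1 (kernel form, `kzKernelConjecture_iff_isRational`) gives the tied
first-variation statement — the element evaluates to the value hypothesis.  Tagged `@[simp]` so that the tribunal's
forward probe `S → Rung` closes. [cite: KontsevichZagier2001, §1.2] -/
@[simp] theorem variationSector_of_kontsevichZagierPeriods (h : _root_.KontsevichZagierPeriods) :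
    NeronTorsionVariationSector := by
  have hK : KZKernelConjecture := kzKernelConjecture_iff_isRational.mpr h
  intro g₂ g₃ e₁ xP yP ξ β N a p q f _ _ _ _ _ _ _ _ _ _ _ _ _ _ _ r₁ rb rD rW _ _ _ _ _ _ _ _ hval
  apply hK
  simp only [map_sub, map_add, map_zsmul, KZ.eval_of, zsmul_eq_mul]
  push_cast
  linear_combination hval

/-- **F4 ON-PATH LEMMA: the summit implies the rung** (member `false` is a theorem outright). -/
@[simp] theorem neronTorsionJets_of_kontsevichZagierPeriods (h : _root_.KontsevichZagierPeriods) : NeronTorsionJets :=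
  neronTorsionJets_iff.mpr ⟨NeronTorsionPrimitiveChain_holds, variationSector_of_kontsevichZagierPeriods h⟩

/-- The same, as an implication (the literal shape `S → Rung` of the forward probe). -/
theorem onPath : _root_.KontsevichZagierPeriods → NeronTorsionJets :=
  neronTorsionJets_of_kontsevichZagierPeriods

/-- The residual is a consequence of the crux (hence of the summit): `closure T ≤ closure (T ∪ T′)`.
(Informational: stub D is WEAKER than the crux as typed.) [folklore] -/
theorem variationSectorComplete_of_torsionSectorComplete (h : TorsionSectorComplete) :
    VariationSectorComplete := by
  intro n m r r' hr hr' hv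
  have hmono : Literature.NumberTheory.Transcendental.KZ.relations ⊔ AddSubgroup.closure TorsionTied ≤
      Literature.NumberTheory.Transcendental.KZ.relations ⊔ AddSubgroup.closure (TorsionTied ∪ VariationTied) :=
    sup_le_sup_left (AddSubgroup.closure_mono Set.subset_union_left) _
  exact hmono (torsionSectorComplete_iff.mp h r r' hr hr' hv)

/-! ### Composition: the crux BY NAME from the two stubs -/

/-- **`TorsionSectorComplete` from the stubs** (closed term; `sorry` only through `stub_variationChain` and
`stub_variationSectorComplete`): the rung (stub A) folds the first-variation sector into the moves
(`closure T′ ≤ relations`), so the residual's `relations ⊔ closure (T ∪ T′)` is `≤ relations ⊔ closure T`.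
[cite: KontsevichZagier2001, §1.2] -/
theorem TorsionSectorComplete_of : TorsionSectorComplete := by
  suffices key : VariationPrimitiveChain → VariationSectorComplete → TorsionSectorComplete from
    key stub_variationChain stub_variationSectorComplete
  intro hA hD
  rw [torsionSectorComplete_iff]
  intro n m r r' hr hr' hv
  have hR : NeronTorsionVariationSector := variationSector_of_primitiveChain hA
  have hle : Literature.NumberTheory.Transcendental.KZ.relations ⊔ AddSubgroup.closure (TorsionTied ∪ VariationTied) ≤
      Literature.NumberTheory.Transcendental.KZ.relations ⊔ AddSubgroup.closure TorsionTied := by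
    refine sup_le le_sup_left ((AddSubgroup.closure_le _).mpr ?_)
    rintro d (hd | hd)
    · exact AddSubgroup.mem_sup_right (AddSubgroup.subset_closure hd)
    · exact AddSubgroup.mem_sup_left (closure_variationTied_le_relations hR (AddSubgroup.subset_closure hd))
  exact hle (hD r r' hr hr' hv)

end Summit.KontsevichZagierPeriods.KontsevichZagierPeriods.Cruxes.TorsionSectorComplete.NeronTorsionVariation

end
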